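import Mathlib
import Summits.Ventures.FusionMHD.Models.SolovevPCFMercierAxis
import HarnessLib

/-!
# Ventures/FusionMHD — Models/SolovevPCFMercierAxisShaped.lean: the F1.MER-axis rows of the PCF instances in FREIDBERG'S (12.89) form —
# a second printed lineage for the certified near-axis Mercier thresholds (rider; no new number)

HONEST FRAMING (LADDER-GRIDFUSION three columns; rung F1.MER-axis, S1/S2 rows «F1 Mercier near-axis ITER-like / NSTX-like»,
Bench p472219 / p472230, Models `SolovevPCFMercierAxis` p472379).  Those rows certify Bateman's (7.3.2) near-axis Mercier criterion
(lit-3 `MercierNearAxis.MercierCriterion`, `δ = 1`) with `Q = 0`, `d = 0` on the shape-fitted PCF instances.  gridfusion-lit-3 (g6, p504651)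
PROVED that Bateman (7.3.2) is, coefficient by coefficient, Freidberg 2014 (12.89) (`ShapedAxisCriterion q₀ κ (δ/ε) β_p0 := 1 < q₀²·shapedBound …`)
under `κ = e`, `β_p0 = 1 − Q`, `δ/ε = e·Δ(e, Q, d)` — and for `Q = 0`, `d = 0` the Freidberg parameters are `(κ, δ/ε, β_p0) = (e, 1/2, 1)`
(`bound_zero_zero_eq_shapedBound`).  THIS FILE records the consequence for the two PCF instances of record (no new enclosure, no decide):
`mercierNearAxis_iff_shaped` — on each instance, for every `F ≠ 0`, Bateman's criterion ⟺ Freidberg's `ShapedAxisCriterion (q₀ F) κ₀ (1/2) 1`;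
hence the certified thresholds (ITER-like: holds ∀ F ≥ 0.6191, fails ∀ 0 < F ≤ 0.619; NSTX-like: 1.1186 / 1.1185) are thresholds of TWO printed
criteria of independent lineage (Bateman 1978 (7.3.2) [Lortz–Nührenberg 1973 lineage] and Freidberg 2014 (12.89) [Solov'ev 1969 / Laval 1971 /
Lortz–Nührenberg 1973 / Mikhailovskii–Shafranov 1974 summary]).  MODELLED: near-axis expansion criteria, necessary only; analytic PCF equilibria;
no stability claim.  Typer/prover: gridfusion-model-5 (g5), 2026-08-27.  Citations: Bateman 1978 §7.3 (7.3.2) [Bateman1978]; Freidberg 2014 §12.5.4 (12.89) [Freidberg2014].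
-/

noncomputable section

namespace Summit.Ventures.FusionMHD.Models.SolovevPCF

open Literature.MathematicalPhysics.MHD Literature.MathematicalPhysics.MHD.GradShafranov
  Literature.MathematicalPhysics.MHD.FluxGeometry Literature.MathematicalPhysics.MHD.Solovev
  Literature.MathematicalPhysics.MHD.Mercier.NearAxis

namespace IterLike

/-- `q₀(F) ≠ 0` for `F ≠ 0` (from `q₀² = F²·r`, `r > 0`). -/
theorem q0_ne_zero {F : ℝ} (hF : F ≠ 0) : safetyFactorOnAxis F Ra (dRR psi Ra 0) (dZZ psi Ra 0) ≠ 0 := by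
  intro h0
  have h2 := q0_sq F
  rw [h0] at h2
  have hr : (0 : ℝ) < q0SqOverFSq := by unfold q0SqOverFSq; norm_num
  have : 0 < F ^ 2 * q0SqOverFSq := by positivity
  simp at h2
  rcases h2 with h | h
  · exact hF h
  · linarith

/-- **Bateman ⟺ Freidberg on the ITER-like PCF axis:** for every `F ≠ 0`, the near-axis Mercier criterion of the row of record
(`Q = 0`, `d = nearAxisD psi Ra = 0`) is Freidberg's shaped on-axis criterion (12.89) at `(κ, δ/ε, β_p0) = (κ₀, 1/2, 1)`. -/
theorem mercierNearAxis_iff_shaped {F : ℝ} (hF : F ≠ 0) :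
    MercierCriterion (safetyFactorOnAxis F Ra (dRR psi Ra 0) (dZZ psi Ra 0))
        (elongationOnAxis (dRR psi Ra 0) (dZZ psi Ra 0)) 0 (nearAxisD psi Ra)
      ↔ ShapedAxisCriterion (safetyFactorOnAxis F Ra (dRR psi Ra 0) (dZZ psi Ra 0))
          (elongationOnAxis (dRR psi Ra 0) (dZZ psi Ra 0)) (1 / 2) 1 := by
  rw [nearAxisD_eq, mercierCriterion_iff_shapedAxisCriterion (q0_ne_zero hF) elongationOnAxis_pos, triangularity_zero_zero]
  have he := elongationOnAxis_pos
  have e1 : elongationOnAxis (dRR psi Ra 0) (dZZ psi Ra 0) * (1 / (2 * elongationOnAxis (dRR psi Ra 0) (dZZ psi Ra 0))) = 1 / 2 := by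
    field_simp
  rw [e1]
  norm_num

/-- Hence Freidberg's (12.89) HOLDS on the ITER-like PCF axis for every `F ≥ 0.6191` … -/
theorem shapedAxisCriterion_of_le {F : ℝ} (hF : FmercierAxis ≤ F) :
    ShapedAxisCriterion (safetyFactorOnAxis F Ra (dRR psi Ra 0) (dZZ psi Ra 0))
      (elongationOnAxis (dRR psi Ra 0) (dZZ psi Ra 0)) (1 / 2) 1 := by
  have hF0 : 0 < F := lt_of_lt_of_le (by unfold FmercierAxis; norm_num) hF
  exact (mercierNearAxis_iff_shaped hF0.ne').mp (mercierNearAxis_of_le hF)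

/-- … and FAILS for every `0 < F ≤ 0.619`. -/
theorem not_shapedAxisCriterion_of_le {F : ℝ} (hF0 : 0 < F) (hF : F ≤ 619 / 1000) :
    ¬ ShapedAxisCriterion (safetyFactorOnAxis F Ra (dRR psi Ra 0) (dZZ psi Ra 0))
      (elongationOnAxis (dRR psi Ra 0) (dZZ psi Ra 0)) (1 / 2) 1 := by
  rw [← mercierNearAxis_iff_shaped hF0.ne']
  exact not_mercierNearAxis_of_le hF0 hF

end IterLike

namespace NstxLike

/-- `q₀(F) ≠ 0` for `F ≠ 0`. -/
theorem q0_ne_zero {F : ℝ} (hF : F ≠ 0) : safetyFactorOnAxis F Ra (dRR psi Ra 0) (dZZ psi Ra 0) ≠ 0 := by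
  intro h0
  have h2 := q0_sq F
  rw [h0] at h2
  have hr : (0 : ℝ) < q0SqOverFSq := by unfold q0SqOverFSq; norm_num
  have : 0 < F ^ 2 * q0SqOverFSq := by positivity
  simp at h2
  rcases h2 with h | h
  · exact hF h
  · linarith

/-- **Bateman ⟺ Freidberg on the NSTX-like PCF axis** (`(κ, δ/ε, β_p0) = (κ₀, 1/2, 1)`). -/
theorem mercierNearAxis_iff_shaped {F : ℝ} (hF : F ≠ 0) :
    MercierCriterion (safetyFactorOnAxis F Ra (dRR psi Ra 0) (dZZ psi Ra 0))
        (elongationOnAxis (dRR psi Ra 0) (dZZ psi Ra 0)) 0 (nearAxisD psi Ra)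
      ↔ ShapedAxisCriterion (safetyFactorOnAxis F Ra (dRR psi Ra 0) (dZZ psi Ra 0))
          (elongationOnAxis (dRR psi Ra 0) (dZZ psi Ra 0)) (1 / 2) 1 := by
  rw [nearAxisD_eq, mercierCriterion_iff_shapedAxisCriterion (q0_ne_zero hF) elongationOnAxis_pos, triangularity_zero_zero]
  have he := elongationOnAxis_pos
  have e1 : elongationOnAxis (dRR psi Ra 0) (dZZ psi Ra 0) * (1 / (2 * elongationOnAxis (dRR psi Ra 0) (dZZ psi Ra 0))) = 1 / 2 := by
    field_simp
  rw [e1]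
  norm_num

/-- Freidberg's (12.89) HOLDS on the NSTX-like PCF axis for every `F ≥ 1.1186` … -/
theorem shapedAxisCriterion_of_le {F : ℝ} (hF : FmercierAxis ≤ F) :
    ShapedAxisCriterion (safetyFactorOnAxis F Ra (dRR psi Ra 0) (dZZ psi Ra 0))
      (elongationOnAxis (dRR psi Ra 0) (dZZ psi Ra 0)) (1 / 2) 1 := by
  have hF0 : 0 < F := lt_of_lt_of_le (by unfold FmercierAxis; norm_num) hF
  exact (mercierNearAxis_iff_shaped hF0.ne').mp (mercierNearAxis_of_le hF)

/-- … and FAILS for every `0 < F ≤ 1.1185`. -/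
theorem not_shapedAxisCriterion_of_le {F : ℝ} (hF0 : 0 < F) (hF : F ≤ 2237 / 2000) :
    ¬ ShapedAxisCriterion (safetyFactorOnAxis F Ra (dRR psi Ra 0) (dZZ psi Ra 0))
      (elongationOnAxis (dRR psi Ra 0) (dZZ psi Ra 0)) (1 / 2) 1 := by
  rw [← mercierNearAxis_iff_shaped hF0.ne']
  exact not_mercierNearAxis_of_le hF0 hF

end NstxLike

end Summit.Ventures.FusionMHD.Models.SolovevPCF
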